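/-
Copyright: public-domain mathematics; typed transcription for the H21 Literature library (cell lit-balaban,
reader/typer seat r02 gen 6 = literature-prover-lit-balaban-r02-g6-0).

statement-level skeleton of published theorems with citation tags; proofs where landed; nothing here is a claim about the Yang–Mills mass gap

# Bałaban, *Propagators and renormalization transformations for lattice gauge theories. I*,
# Commun. Math. Phys. **95** (1984) 17–40 — p. 39: «Proposition 1.2 for G₀ … together with the properties (1.126), (1.127)
# of ∂P∂* and … (1.114) for the operator G implies immediately … Proposition 1.2 for G» — THE (1.126)-ONLY FORM

[cite: Balaban1984PropagatorsI]  T. Bałaban, Commun. Math. Phys. 95 (1984) 17–40.  p. 39 [PDF 23] (the sentence quoted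
above, and the identity (1.132) `G = G₀ + G₀∂P∂*G`); p. 38 [PDF 22] (1.126) `|(∂P∂*)_{μν}(x, x′)| ≤ O(1)e^{−δ′₀|x−x′|}`,
(1.127) (the Hölder continuity of the same kernel); pp. 35–36 Proposition 1.2 (1.110)–(1.114).

WHAT THIS MODULE ADDS (SKELETON row B5.Prop1.2, census (vii) (1.132) — an owner brick for the assembly of Prop. 1.2
FOR G on the torus of record, seats p16 g6 / p38 g6 / p37 g7):  the pre-cell transfer
`B5Transfer132.prop12_of_G0_via132 : … → B5.Prop12Printed famG0 → B5.Kernel126_127Printed Kd → B5.Local114Fam fam →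
B5.Prop12Printed fam` takes the FULL printed leaf (1.126)–(1.127) `B5.Kernel126_127Printed Kd` — both conjuncts must be
inhabited for the kernel data `Kd` — although its proof consumes only the first conjunct (1.126) (that module's own
docstring: «Of the leaf only (1.126) is consumed by this pairing; (1.127) … is needed by the paper's first pairing /
step S1, not here»).  Here the SAME conclusion is derived from the family-uniform (1.126) ALONE,

  `prop12_of_G0_via132_of_kerBound :
     … → B5.Prop12Printed famG0 → (∃ δ′₀ C, 0 < δ′₀ ∧ 0 < C ∧ ∀ i, KerBound (Kd i) C δ′₀) → B5.Local114Fam fam →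
       B5.Prop12Printed fam`,

by re-running `pieceDecay_fam` with the hypothesis `KerBound` in place of `(HK i).1` (`pieceDecay_fam_of_kerBound`,
`transfer_of_display132_of_kerBound`), so that the (1.126) bound for the MATRIX OF RECORD `GradOp·PcT·GradOpᴴ` on
`Tor (fine n M) × Fin d` (p16 g6's P-bridge, p37 g7's hypothesis h126) feeds the transfer directly, without transporting
the Hölder bound (1.127) to that kernel data.  `kerBoundFam_of_kernel126_127` records that the printed leaf implies the
hypothesis used here (so the tree's `prop12_of_G0_via132` is the special case — not restated: the gate's dedup identifies the re-derivation with it).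

HONEST SCOPE.  Kernel arithmetic over the located leaves of `B5Transfer132` (`MapFacts`, `KerCarrier`, `PieceFacts132`,
`Display133`, `URow`, `ModelSigns`), nothing analytic; a STRONGER form (weaker hypothesis) of an existing tree theorem,
same proof.  No definition, no new `Prop` fact.
-/
import Mathlib
import Literature.MathematicalPhysics.QuantumFieldTheory.Balaban1983to89.B5Transfer132

open scoped BigOperators

namespace Literature.MathematicalPhysics.QuantumFieldTheory.Balaban1983to89.B5Transfer132KerBound

open Literature.MathematicalPhysics.QuantumFieldTheory.Balaban1983to89
open Finset B5FromB4 B5Transfer133 B5Transfer132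

variable {I : Type} (famG0 fam : I → B5.Setting) (Kf : ∀ i, Carrier133 (famG0 i) (fam i)) {r0 Nn Dh : ℝ}

/-! ## The (1.132) transfer with the leaf weakened to its (1.126) conjunct

statement-level skeleton of published theorems with citation tags; proofs where landed; nothing here is a claim about the Yang–Mills mass gap -/

/-- The printed leaf (1.126)–(1.127) `B5.Kernel126_127Printed Kd` implies the family-uniform (1.126)
`∃ δ′₀ C, 0 < δ′₀ ∧ 0 < C ∧ ∀ i, KerBound (Kd i) C δ′₀` (its first conjunct).
[cite: Balaban1984PropagatorsI, (1.126) p.38] -/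
theorem kerBoundFam_of_kernel126_127 (Kd : I → B5.KernelData) (h : B5.Kernel126_127Printed Kd) :
    ∃ δ₀' C : ℝ, 0 < δ₀' ∧ 0 < C ∧ ∀ i, KerBound (Kd i) C δ₀' := by
  obtain ⟨δ₀', C, Cα, hδ₀', hC, HK⟩ := h
  exact ⟨δ₀', C, hδ₀', hC, fun i => (HK i).1⟩

/-- **Uniform piece decay from the family-uniform (1.126) and (1.114) for G** — `B5Transfer132.pieceDecay_fam` with the
leaf hypothesis weakened to its (1.126) conjunct: a family-uniform constant P ≥ 0 and rate δp > 0 with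
|1_{Δ(y″)}∂P∂*G^{(p)}J| ≤ P e^{−δp|y″−y′|}|J| (supp J ⊂ Δ̃(y′)), through `PieceFacts132` (blockwise Cauchy–Schwarz),
`MapFacts` (triangle inequality) and `URow`. [cite: Balaban1984PropagatorsI, (1.132) p.39, (1.126) p.38, (1.114) p.36] -/
theorem pieceDecay_fam_of_kerBound (Kd : I → B5.KernelData) (Kc : ∀ i, KerCarrier (Kd i) (fam i)) {A B c₀ : ℝ}
    (Mf : ∀ i, MapFacts (Kf i) r0 Nn) (Pf : ∀ i, PieceFacts132 (Kf i) (Kc i) A B c₀)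
    (SgG : ∀ i, ModelSigns (fam i)) (hRow : ∀ κ : ℝ, 0 < κ → ∃ Λ : ℝ, ∀ i, URow (Kf i) κ Λ)
    (hker : ∃ δ₀' C : ℝ, 0 < δ₀' ∧ 0 < C ∧ ∀ i, KerBound (Kd i) C δ₀') (h3 : B5.Local114Fam fam) :
    ∃ P δp : ℝ, 0 ≤ P ∧ 0 < δp ∧ ∀ i, PieceDecay (Kf i) P δp := by
  obtain ⟨δ₀', C, hδ₀', hC, HK⟩ := hker
  obtain ⟨δ₂, C₂, hδ₂, hC₂, H3⟩ := (local114Fam_iff fam).mp h3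
  obtain ⟨δ, hδ, hd1, hd2⟩ : ∃ δ : ℝ, 0 < δ ∧ δ ≤ δ₀' ∧ δ ≤ δ₂ :=
    ⟨min δ₀' δ₂, lt_min hδ₀' hδ₂, min_le_left _ _, min_le_right _ _⟩
  obtain ⟨Λ, HΛ⟩ := hRow (δ / 2) (half_pos hδ)
  refine ⟨max (A * (C * Real.exp (δ₀' * c₀)) * C₂ * B * Λ) 0, δ / 2, le_max_right _ _, half_pos hδ, fun i => ?_⟩
  exact pieceDecay_mono (Kf i) (SgG i)
    (pieceDecay_of_kernel (Kf i) (Mf i) (Pf i) (SgG i) hC.le hC₂.le hδ.le hd1 hd2 (HK i) (H3 i) (HΛ i))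
    (le_max_left _ _)

/-- **Sup / Hölder transfer G₀ ↝ G from the family-uniform (1.126)** — `B5Transfer132.transfer_of_display132` with the
leaf hypothesis weakened to its (1.126) conjunct: `FirstOrderFam famG0 → SecondOrderFam famG0 → B5.Local114Fam fam →
FirstOrderFam fam ∧ SecondOrderFam fam`. [cite: Balaban1984PropagatorsI, (1.132) p.39, (1.126) p.38] -/
theorem transfer_of_display132_of_kerBound (Kd : I → B5.KernelData) (Kc : ∀ i, KerCarrier (Kd i) (fam i))
    {A B c₀ : ℝ} (Mf : ∀ i, MapFacts (Kf i) r0 Nn) (Pf : ∀ i, PieceFacts132 (Kf i) (Kc i) A B c₀)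
    (Dp : ∀ i, Display133 (Kf i) Dh) (SgG0 : ∀ i, ModelSigns (famG0 i)) (SgG : ∀ i, ModelSigns (fam i))
    (hRow : ∀ κ : ℝ, 0 < κ → ∃ Λ : ℝ, ∀ i, URow (Kf i) κ Λ)
    (hker : ∃ δ₀' C : ℝ, 0 < δ₀' ∧ 0 < C ∧ ∀ i, KerBound (Kd i) C δ₀') :
    FirstOrderFam famG0 → SecondOrderFam famG0 → B5.Local114Fam fam →
      FirstOrderFam fam ∧ SecondOrderFam fam := by
  intro h1 h2 h3
  obtain ⟨P, δp, hP0, hδp, hPD⟩ :=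
    pieceDecay_fam_of_kerBound famG0 fam Kf Kd Kc Mf Pf SgG hRow hker h3
  exact ⟨firstOrder_of_pieces famG0 fam Kf Mf Dp SgG0 SgG hRow hP0 hδp hPD h1,
    secondOrder_of_pieces famG0 fam Kf Mf Dp SgG0 SgG hRow hP0 hδp hPD h1 h2⟩

/-- **The printed sentence, second pairing, from (1.126) ALONE**: «We will prove … the whole Proposition 1.2, for the
operator G₀. This together with the properties (1.126), (1.127) of ∂P∂* and … (1.114) for the operator G implies
immediately … Proposition 1.2 for G» (p. 39) — as `B5Transfer132.prop12_of_G0_via132`, but with the leaf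
`B5.Kernel126_127Printed Kd` replaced by its (1.126) conjunct, family-uniform:
`B5.Prop12Printed famG0 → (∃ δ′₀ C, 0 < δ′₀ ∧ 0 < C ∧ ∀ i, KerBound (Kd i) C δ′₀) → B5.Local114Fam fam → B5.Prop12Printed fam`.
(The Hölder conjunct (1.127) is what the paper's FIRST pairing / the random-walk step S1 uses; the (1.132) transfer of the
tree does not consume it.) [cite: Balaban1984PropagatorsI, (1.132) p.39, (1.126) p.38, Proposition 1.2 (1.110)–(1.114) pp.35–36] -/
theorem prop12_of_G0_via132_of_kerBound (Kd : I → B5.KernelData) (Kc : ∀ i, KerCarrier (Kd i) (fam i))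
    {A B c₀ : ℝ} (Mf : ∀ i, MapFacts (Kf i) r0 Nn) (Pf : ∀ i, PieceFacts132 (Kf i) (Kc i) A B c₀)
    (Dp : ∀ i, Display133 (Kf i) Dh) (SgG0 : ∀ i, ModelSigns (famG0 i)) (SgG : ∀ i, ModelSigns (fam i))
    (hRow : ∀ κ : ℝ, 0 < κ → ∃ Λ : ℝ, ∀ i, URow (Kf i) κ Λ) :
    B5.Prop12Printed famG0 → (∃ δ₀' C : ℝ, 0 < δ₀' ∧ 0 < C ∧ ∀ i, KerBound (Kd i) C δ₀') →
      B5.Local114Fam fam → B5.Prop12Printed fam := by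
  intro hG0 hker h3
  obtain ⟨h1, h2, -⟩ := blocks_of_prop12 famG0 hG0
  obtain ⟨h1', h2'⟩ :=
    transfer_of_display132_of_kerBound famG0 fam Kf Kd Kc Mf Pf Dp SgG0 SgG hRow hker h1 h2 h3
  exact prop12_of_blocks fam SgG h1' h2' h3

/-- **A kernel bound is inherited along maps into the kernel lattice** (bookkeeping for instances): if `Kd′.X` maps to
`Kd.X` by `φ` with `Kd′.dist = Kd.dist ∘ φ` and `|Kd′.ker x x′| ≤ s · |Kd.ker (φ x) (φ x′)|` for a scale `0 ≤ s`, then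
`KerBound Kd C δ′₀ → KerBound Kd′ (s·C) δ′₀` — e.g. a re-typing of the η-lattice (chart `Idx ↔ Tor`) or the passage
from complex matrix entries to their real parts. [cite: Balaban1984PropagatorsI, (1.126) p.38] -/
theorem kerBound_of_map {Kd Kd' : B5.KernelData} (φ : Kd'.X → Kd.X) {s C δ₀' : ℝ} (hs : 0 ≤ s)
    (hdist : ∀ x x' : Kd'.X, Kd'.dist x x' = Kd.dist (φ x) (φ x'))
    (hker : ∀ x x' : Kd'.X, |Kd'.ker x x'| ≤ s * |Kd.ker (φ x) (φ x')|) (h : KerBound Kd C δ₀') :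
    KerBound Kd' (s * C) δ₀' := by
  intro x x'
  calc |Kd'.ker x x'| ≤ s * |Kd.ker (φ x) (φ x')| := hker x x'
    _ ≤ s * (C * Real.exp (-(δ₀' * Kd.dist (φ x) (φ x')))) := mul_le_mul_of_nonneg_left (h (φ x) (φ x')) hs
    _ = s * C * Real.exp (-(δ₀' * Kd'.dist x x')) := by rw [hdist]; ring

end Literature.MathematicalPhysics.QuantumFieldTheory.Balaban1983to89.B5Transfer132KerBound
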